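import Summits.BirchSwinnertonDyer.BirchSwinnertonDyer.Theorems.AlignedTransportAtTwoMainConjectureOfRankZeroBSDAtTwoSexticNormRelationDescentMu
import Summits.BirchSwinnertonDyer.BirchSwinnertonDyer.Theorems.AlignedTransportAtTwoMainConjectureOfRankZeroBSDAtTwoCubicChevalleyRow307b1ClassNumber
import Summits.BirchSwinnertonDyer.BirchSwinnertonDyer.Theorems.AlignedTransportAtTwoMainConjectureOfRankZeroBSDAtTwoCubicChevalleyRow139a1ClassNumber
import Summits.BirchSwinnertonDyer.BirchSwinnertonDyer.Theorems.AlignedTransportAtTwoMainConjectureOfRankZeroBSDAtTwoResolventTowerGenusStable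
import Literature.NumberTheory.NumberFields.ClassGroupCoprimeGaloisDescentCongruence
import HarnessLib

/-!
# Route `AlignedTransportAtTwo`, crux C2 `MainConjectureOfRankZeroBSDAtTwo` (stmt-BirchSwinnertonDyer-22298):
# THE `S₃` NORM-RELATION DESCENT AT `p = 2`, part 3 — the SEXTIC rows `307b1` and `139a1`: `2 ∤ h(ℚ(W[2])_n)` for EVERY layer, UNCONDITIONAL

Sequel of `…SexticNormRelationDescent(Mu)` (same seat bsd-line-att-p4 g28). HONEST FRAMING: WIDTH-5 attached prover seat on line `birth` of the lead `bsd-line-att-p2`;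
`--supports` stmt-BirchSwinnertonDyer-22298, closes nothing; BSD is NOT proved; crux C2, its verdict «blocked-on `Rank1Residual.GreenbergMuConjectureIrreducible`» and every
registered stub untouched. THEOREMS ONLY.

WHAT. §1 `e_n = 0 ⟸ rank₂ = 0` at one layer (`#Cl[2] = 2^{rank₂ Cl}`, Cauchy). §2 ★★★ `classNumberPExp_divisionField_two_307b1_eq_zero`: for EVERY cyclotomic
`ℤ₂`-extension of the `S₃`-SEXTIC `T = ℚ(307b1[2])` and every `n`, `2 ∤ h(T_n)` (`λ₂ = μ₂ = ν₂ = 0`) — UNCONDITIONAL: part 2's descent fed with att-p4 g27's cubic theorem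
`classNumberPExp_cubicField_307b1_eq_zero` (`h(ℚ(β)) = 1` kernel + Chevalley + Fukuda) at each of the three roots, and att-p3 g30's resolvent formula
`classGroupPRank_resolvent_eq_sum` (`rank₂ Cl(ℚ(√−307)_n) = 2^{min(n, ord₂(307²−1)−3)} − 1 = 0`, `307 ≡ 3 (mod 8)`); `classicalMuVanishes_divisionField_two_307b1`.
Same for `139a1` (`139 ≡ 3 (mod 8)`, `h(ℚ(β)) = 1`, g27 p767522). These are the first kernel instances of statement (A)₂ / Lim's hypothesis on its NATURAL carrier
`ℚ(W[2])` (`E[2] ⊆ E(T)`) for `S₃`-image curves — no Iwasawa 1973, no Ferrero–Washington, no class-group computation in degree `6·2ⁿ`. Instance bookkeeping; nothing closed.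

References: [BiasseEtAl2022] Prop. 3.7; [Washington1997] §10.1, §13.1; [Ferrero1980AJM] §2; [Fukuda1994] Thm. 1; tree: parts 1–2 (this seat), `…Row307b1ClassNumber` /
`…Row139a1ClassNumber` (att-p4 g27), `…ResolventTowerGenusStable` (att-p3 g30), `ClassGroupCoprimeGaloisDescentCongruence` (cell bsd-potss).
-/

set_option linter.dupNamespace false
set_option autoImplicit false

noncomputable section

open scoped Classical NumberField

namespace Summit.BirchSwinnertonDyer.BirchSwinnertonDyer.Theorems.AlignedTransportAtTwoSexticNormRelationDescentSeeds

open NumberField Polynomial WeierstrassCurve IntermediateField Field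
  Literature.NumberTheory.EllipticCurves Literature.NumberTheory.EllipticCurves.Greenberg1999
  Literature.NumberTheory.EllipticCurves.DokchitserDokchitser2012
  Literature.NumberTheory.EllipticCurves.ZpExtension Literature.NumberTheory.GaloisRepresentations
  Literature.NumberTheory.IwasawaTheory Literature.NumberTheory.NumberFields
  Summit.BirchSwinnertonDyer.BirchSwinnertonDyer.Theorems.AlignedTransportAtTwoFineRoad.DivisionCubic
  Summit.BirchSwinnertonDyer.BirchSwinnertonDyer.Theorems.AlignedTransportAtTwoSexticNormRelationDescent
  Summit.BirchSwinnertonDyer.BirchSwinnertonDyer.Theorems.AlignedTransportAtTwoSexticNormRelationDescentMu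
  Summit.BirchSwinnertonDyer.BirchSwinnertonDyer.Theorems.AlignedTransportAtTwoResolventTowerGenusStable
  Summit.BirchSwinnertonDyer.BirchSwinnertonDyer.Theorems.AlignedTransportAtTwoCubicChevalleyRow307b1
  Summit.BirchSwinnertonDyer.BirchSwinnertonDyer.Theorems.AlignedTransportAtTwoCubicChevalleyRow307b1ClassNumber
  Summit.BirchSwinnertonDyer.BirchSwinnertonDyer.Theorems.AlignedTransportAtTwoCubicChevalleyRow139a1
  Summit.BirchSwinnertonDyer.BirchSwinnertonDyer.Theorems.AlignedTransportAtTwoCubicChevalleyRow139a1ClassNumber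

/-! ## §1 `rank₂ = 0 ⟹ e_n = 0` -/

/-- **`rank₂ Cl(K_n) = 0 ⟹ 2 ∤ h(K_n)`** (`#Cl[2] = 2^{rank₂}` is then `1`, so `Cl` has no element of order `2`; Cauchy). [cite: Washington1997, §10.1] -/
theorem classNumberPExp_eq_zero_of_classGroupPRank_eq_zero {K : Type} [Field K] [NumberField K] (κ : ZpExtension K 2) (n : ℕ)
    (h : classGroupPRank κ n = 0) : classNumberPExp κ n = 0 := by
  haveI : NumberField (κ.layer n) := NumberField.of_module_finite K _
  haveI : Fact (Nat.Prime 2) := ⟨Nat.prime_two⟩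
  have htors : Nat.card {m : ClassGroup (𝓞 (κ.layer n)) // m ^ 2 = 1} = 1 := by
    rw [natCard_torsion_eq_pow_padicValNat_card_quotient (M := ClassGroup (𝓞 (κ.layer n))) 2, ← classGroupPRank_def, h, pow_zero]
  rw [classNumberPExp_def]
  apply padicValNat.eq_zero_of_not_dvd
  intro hdvd
  rw [Nat.card_eq_fintype_card] at hdvd
  obtain ⟨x, hx⟩ := exists_prime_orderOf_dvd_card 2 hdvd
  have hx1 : x ≠ 1 := by
    intro h1
    rw [h1, orderOf_one] at hx
    exact absurd hx (by decide)
  have hx2 : x ^ 2 = 1 := by have := pow_orderOf_eq_one x; rwa [hx] at this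
  haveI := (Nat.card_eq_one_iff_unique.mp htors).1
  exact hx1 (congrArg Subtype.val (Subsingleton.elim (⟨x, hx2⟩ : {m : ClassGroup (𝓞 (κ.layer n)) // m ^ 2 = 1}) ⟨1, one_pow 2⟩))

/-! ## §2 The sextic `ℚ(307b1[2])`: `e_n = 0` for every `n`, unconditionally -/

/-- The resolvent tower of `307b1` is `2`-class-number free: `rank₂ Cl(ℚ(√−307)_n) = 2^{min(n, 0)} − 1 = 0` (`307` prime, `307² − 1 = 2³·11781`), hence `e_n = 0`.
[cite: Ferrero1980AJM, §2] [cite: Washington1997, §13.1] -/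
theorem classNumberPExp_resolvent_307b1_eq_zero
    [((⟨1, 1, 0, 0, -1⟩ : WeierstrassCurve ℤ).baseChange ℚ).IsElliptic]
    (κk : ZpExtension ↥ℚ⟮4 * delta ((⟨1, 1, 0, 0, -1⟩ : WeierstrassCurve ℤ).baseChange ℚ) two_ne_zero⟯ 2) (hκk : κk.IsCyclotomic) (n : ℕ) :
    classNumberPExp κk n = 0 := by
  haveI : FiniteDimensional ℚ ↥ℚ⟮4 * delta ((⟨1, 1, 0, 0, -1⟩ : WeierstrassCurve ℤ).baseChange ℚ) two_ne_zero⟯ :=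
    IntermediateField.adjoin.finiteDimensional ((AlgebraicClosure.isAlgebraic ℚ).isAlgebraic _).isIntegral
  haveI : NumberField ↥ℚ⟮4 * delta ((⟨1, 1, 0, 0, -1⟩ : WeierstrassCurve ℤ).baseChange ℚ) two_ne_zero⟯ := NumberField.mk
  apply classNumberPExp_eq_zero_of_classGroupPRank_eq_zero
  have hΔ : ((⟨1, 1, 0, 0, -1⟩ : WeierstrassCurve ℤ).baseChange ℚ).Δ = -((307 : ℕ) : ℚ) * (1 : ℚ) ^ 2 := by
    rw [baseChange_int_Δ, M307b1_Δ]; norm_num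
  have h := classGroupPRank_resolvent_eq_sum ((⟨1, 1, 0, 0, -1⟩ : WeierstrassCurve ℤ).baseChange ℚ)
    (by norm_num : Nat.Prime 307).squarefree (by norm_num) one_ne_zero hΔ (delta_mem_and_sq _).2 κk hκk n
  rw [h, Nat.Prime.primeFactors (by norm_num : Nat.Prime 307), Finset.sum_singleton]
  have h3 : padicValNat 2 (307 ^ 2 - 1) = 3 := by
    rw [show (307 : ℕ) ^ 2 - 1 = 2 ^ 3 * 11781 by norm_num, padicValNat.mul (by norm_num) (by norm_num), padicValNat.prime_pow,
      padicValNat.eq_zero_of_not_dvd (by norm_num)]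
  rw [h3]
  simp

/-- ★★★ **`2 ∤ h(ℚ(307b1[2])_n)` for EVERY layer of EVERY cyclotomic `ℤ₂`-extension of the `S₃`-sextic `ℚ(307b1[2])`** (`e_n = 0`: `λ₂ = μ₂ = ν₂ = 0`), UNCONDITIONAL:
the `S₃` norm-relation descent (part 2) fed with `e_n(ℚ(β_j)) = 0` (att-p4 g27: `h(ℚ(β)) = 1`, Chevalley, Fukuda — at each of the three roots) and `e_n(ℚ(√−307)) = 0`
(att-p3 g30: genus theory in `ℚ_n`). [cite: BiasseEtAl2022, Prop. 3.7] [cite: Fukuda1994, Thm. 1 (1), p. 264] [cite: Ferrero1980AJM, §2] [cite: LMFDB, number field 3.1.307.1] -/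
theorem classNumberPExp_divisionField_two_307b1_eq_zero
    [((⟨1, 1, 0, 0, -1⟩ : WeierstrassCurve ℤ).baseChange ℚ).IsElliptic]
    (κT : ZpExtension (((⟨1, 1, 0, 0, -1⟩ : WeierstrassCurve ℤ).baseChange ℚ).divisionField 2) 2) (hκT : κT.IsCyclotomic) (n : ℕ) :
    classNumberPExp κT n = 0 := by
  haveI := isGloballyMinimal_307b1
  refine classNumberPExp_divisionField_two_eq_zero_of_cubic_of_resolvent _ not_hasRationalTwoTorsionX_307b1 Δ_307b1_neg ?_
    (classNumberPExp_resolvent_307b1_eq_zero) κT hκT n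
  intro j κj hκj m
  have hβ : aeval (xT ((⟨1, 1, 0, 0, -1⟩ : WeierstrassCurve ℤ).baseChange ℚ) two_ne_zero j)
      ((⟨1, 1, 0, 0, -1⟩ : WeierstrassCurve ℤ).baseChange ℚ).twoTorsionPolynomial.toPoly = 0 :=
    (mem_rootSet_of_ne (twoTorsionPolynomial_toPoly_ne_zero _ two_ne_zero)).mp (xT_mem_rootSet _ two_ne_zero j)
  exact classNumberPExp_cubicField_307b1_eq_zero hβ κj hκj m

/-- **`μ₂ = 0` for every cyclotomic `ℤ₂`-extension of `ℚ(307b1[2])`**, unconditional (growth form; from `e_n = 0`). [cite: RaySujatha2021, §1 eq. (1.1)] -/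
theorem classicalMuVanishes_divisionField_two_307b1
    [((⟨1, 1, 0, 0, -1⟩ : WeierstrassCurve ℤ).baseChange ℚ).IsElliptic]
    (κT : ZpExtension (((⟨1, 1, 0, 0, -1⟩ : WeierstrassCurve ℤ).baseChange ℚ).divisionField 2) 2) (hκT : κT.IsCyclotomic) : ClassicalMuVanishes κT :=
  classicalMuVanishes_of_eventually_const κT (c := 0) (n₀ := 0) fun n _ => classNumberPExp_divisionField_two_307b1_eq_zero κT hκT n

/-! ## §3 The sextic `ℚ(139a1[2])`: the same, for the smallest conductor of the road -/

/-- The resolvent tower of `139a1` is `2`-class-number free (`139` prime, `139² − 1 = 2³·2415`). [cite: Ferrero1980AJM, §2] [cite: Washington1997, §13.1] -/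
theorem classNumberPExp_resolvent_139a1_eq_zero
    [((⟨1, 1, 0, -3, -4⟩ : WeierstrassCurve ℤ).baseChange ℚ).IsElliptic]
    (κk : ZpExtension ↥ℚ⟮4 * delta ((⟨1, 1, 0, -3, -4⟩ : WeierstrassCurve ℤ).baseChange ℚ) two_ne_zero⟯ 2) (hκk : κk.IsCyclotomic) (n : ℕ) :
    classNumberPExp κk n = 0 := by
  haveI : FiniteDimensional ℚ ↥ℚ⟮4 * delta ((⟨1, 1, 0, -3, -4⟩ : WeierstrassCurve ℤ).baseChange ℚ) two_ne_zero⟯ :=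
    IntermediateField.adjoin.finiteDimensional ((AlgebraicClosure.isAlgebraic ℚ).isAlgebraic _).isIntegral
  haveI : NumberField ↥ℚ⟮4 * delta ((⟨1, 1, 0, -3, -4⟩ : WeierstrassCurve ℤ).baseChange ℚ) two_ne_zero⟯ := NumberField.mk
  apply classNumberPExp_eq_zero_of_classGroupPRank_eq_zero
  have hΔ : ((⟨1, 1, 0, -3, -4⟩ : WeierstrassCurve ℤ).baseChange ℚ).Δ = -((139 : ℕ) : ℚ) * (1 : ℚ) ^ 2 := by
    rw [baseChange_int_Δ, M139a1_Δ]; norm_num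
  have h := classGroupPRank_resolvent_eq_sum ((⟨1, 1, 0, -3, -4⟩ : WeierstrassCurve ℤ).baseChange ℚ)
    (by norm_num : Nat.Prime 139).squarefree (by norm_num) one_ne_zero hΔ (delta_mem_and_sq _).2 κk hκk n
  rw [h, Nat.Prime.primeFactors (by norm_num : Nat.Prime 139), Finset.sum_singleton]
  have h3 : padicValNat 2 (139 ^ 2 - 1) = 3 := by
    rw [show (139 : ℕ) ^ 2 - 1 = 2 ^ 3 * 2415 by norm_num, padicValNat.mul (by norm_num) (by norm_num), padicValNat.prime_pow,
      padicValNat.eq_zero_of_not_dvd (by norm_num)]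
  rw [h3]
  simp

/-- ★★★ **`2 ∤ h(ℚ(139a1[2])_n)` for EVERY layer of EVERY cyclotomic `ℤ₂`-extension of the `S₃`-sextic `ℚ(139a1[2])`**, UNCONDITIONAL (as for `307b1`).
[cite: BiasseEtAl2022, Prop. 3.7] [cite: Fukuda1994, Thm. 1 (1), p. 264] [cite: Ferrero1980AJM, §2] [cite: LMFDB, number field 3.1.139.1] -/
theorem classNumberPExp_divisionField_two_139a1_eq_zero
    [((⟨1, 1, 0, -3, -4⟩ : WeierstrassCurve ℤ).baseChange ℚ).IsElliptic]
    (κT : ZpExtension (((⟨1, 1, 0, -3, -4⟩ : WeierstrassCurve ℤ).baseChange ℚ).divisionField 2) 2) (hκT : κT.IsCyclotomic) (n : ℕ) :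
    classNumberPExp κT n = 0 := by
  haveI := isGloballyMinimal_139a1
  refine classNumberPExp_divisionField_two_eq_zero_of_cubic_of_resolvent _ not_hasRationalTwoTorsionX_139a1 Δ_139a1_neg ?_
    (classNumberPExp_resolvent_139a1_eq_zero) κT hκT n
  intro j κj hκj m
  have hβ : aeval (xT ((⟨1, 1, 0, -3, -4⟩ : WeierstrassCurve ℤ).baseChange ℚ) two_ne_zero j)
      ((⟨1, 1, 0, -3, -4⟩ : WeierstrassCurve ℤ).baseChange ℚ).twoTorsionPolynomial.toPoly = 0 :=
    (mem_rootSet_of_ne (twoTorsionPolynomial_toPoly_ne_zero _ two_ne_zero)).mp (xT_mem_rootSet _ two_ne_zero j)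
  exact classNumberPExp_cubicField_139a1_eq_zero hβ κj hκj m

/-- **`μ₂ = 0` for every cyclotomic `ℤ₂`-extension of `ℚ(139a1[2])`**, unconditional. [cite: RaySujatha2021, §1 eq. (1.1)] -/
theorem classicalMuVanishes_divisionField_two_139a1
    [((⟨1, 1, 0, -3, -4⟩ : WeierstrassCurve ℤ).baseChange ℚ).IsElliptic]
    (κT : ZpExtension (((⟨1, 1, 0, -3, -4⟩ : WeierstrassCurve ℤ).baseChange ℚ).divisionField 2) 2) (hκT : κT.IsCyclotomic) : ClassicalMuVanishes κT :=
  classicalMuVanishes_of_eventually_const κT (c := 0) (n₀ := 0) fun n _ => classNumberPExp_divisionField_two_139a1_eq_zero κT hκT n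

end Summit.BirchSwinnertonDyer.BirchSwinnertonDyer.Theorems.AlignedTransportAtTwoSexticNormRelationDescentSeeds

end
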